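import Mathlib
import Literature.MathematicalPhysics.QuantumFieldTheory.Balaban1983to89.B5Blocks16
import Literature.MathematicalPhysics.QuantumFieldTheory.BalabanImbrieJaffe1984to88.BIJ85Eq7111CrossSymbols

/-!
# `BalabanImbrieJaffe1984to88.BIJ85Eq7111EdgeAverage` — T. Bałaban, J. Imbrie, A. Jaffe, *Renormalization of the Higgs
model: minimizers, propagators and the stability of mean field theory*, Commun. Math. Phys. **97** (1985) 299–329
[BalabanImbrieJaffe1985]: Sect. 2 p. 305 (2.21)/(2.24) and Sect. 7.1 p. 322 (7.1.11) — **the k-fold edge average `Q^e_k = (Q^e)^k`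
in configuration space on the η-lattice torus and ITS MOMENTUM REPRESENTATION (7.1.11), PROVED with the exact weight**:
`(Q^e_k f)~_{μν}(p′) = c·Σ_l w_{μν}(p′+l) f̃_{μν}(p′+l)`, `w_{μν}(p) = e^{i(1−η)(p_μ+p_ν)}·Π_{ρ∉{μ,ν}} v_ρ(p)` — equal to
`u/(v̄_μ v̄_ν)` (division-free: `w_{μν}·v̄_μ v̄_ν = u`); the printed weight `u(v_μ v_ν)^{−1}` of (7.1.11) is `w_{μν}` WITHOUT the
base-point phase `e^{i(1−η)(p_μ+p_ν)}` (same modulus), and it is the phase-carrying `w` for which (7.1.14)'s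
`|u|²/(v̄_μ v̄_ν v_λ v_κ) = w_{μν}·w̄_{λκ}` is literal (`HOME/GAPS.md` G-C1-p27-01) — file 12 of the (7.1.2) cluster, sibling of
`BIJ85Eq7111CrossSymbols` (`dftC_mulVec_cross` = the shape of (7.1.11) for every translation-invariant cross-lattice operator)

statement-level skeleton of published theorems with citation tags; proofs where landed; nothing here is a claim about
the Yang–Mills mass gap

PDF held: `paper:balaban1985-cmp97-bij-higgs-minimizers` (journal page = PDF page + 298).  Text read as images: PDF p. 7
(journal 305; `run/shared/lean/pub/lit-balaban/lit-balaban-r15/pages/1985-cmp97-bij-higgs-minimizers-p007-x2.png`) and PDF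
p. 24 (journal 322; `run/shared/lean/pub/pub-balaban/b2b-balaban-beta-lit3-g8/pages/1985-cmp97-bij-higgs-minimizers-p024-x2.png`).

CITATION HEADER (lean-in-tree rule).  Part of the lit-balaban TYPED SKELETON (HOME `run/shared/lean/pub/lit-balaban/`); WHAT IS
REPRODUCED: display **(7.1.11)** of SKELETON row **C1.Eq7.1.2-7.1.12** (p. 322 [PDF 24], verbatim: *"In terms of these functions
we can express the averaging operators Q^e_k, etc. For example (Q^e_k f)~_{μν}(p′) = Σ_l u(p′+l) f̃_{μν}(p′+l)
(v_μ(p′+l)v_ν(p′+l))^{−1}. (7.1.11)"*) for the operator of rows C1.Eq2.20-2.23 / C1.Eq2.24 (p. 305 [PDF 7], verbatim: *"Let p′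
denote an L-lattice plaquette. The set of edge plaquettes B^e(p′) are defined as those unit plaquettes p which (i) are parallel
to p′, (ii) whose bonds touch four distinct L-blocks, and (iii) such that these L-blocks contain the corners of p′ (see Fig. 1).
The edge average Q^e is defined by (Q^e f)(p′) = L^{−(d−2)} Σ_{p∈B(p′)} f(p). (2.21) … We also need the k-fold averaging operators
Q_k ≡ (Q)^k, etc. Especially important are Q^e_k ≡ (Q^e)^k and Q^s_k = (Q^s)^k which satisfy Q^e_kQ^{e*}_k = L^{2k}I = η^{−2}I,
… (2.24)"*), `HOME/lit-balaban-r15/ROWS-C1.md` (owner r15, referee ref-5).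
TYPED READING.  As in `BIJ85Eq7111CrossSymbols`/pub-balaban `B5Block118` (η-torus `Tor (fine n M)`, `n = η^{−1} = L^k`, unit
torus `Tor M` embedded by `up : y ↦ n·y`, blocks `B^k(y) = {bpt y j = n·y + j}`, plaquette components `Fin d × Fin d` with
base-point labelling as in `BIJ85Eq715ConfigSymbols.curlC`).  Composing (2.21) k times (each step keeps, inside an L-block, the
LAST unit layer before the next block in both plaquette directions, transverse coordinates free) gives on the η-lattice:
`B^e_k(y; μν)` = the η-plaquettes parallel to `μν` at `x = n·y + j`, `j_μ = j_ν = n − 1` (`x_μ = y_μ + 1 − η`, `x_ν = y_ν + 1 − η`),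
`j_ρ` free for `ρ ∉ {μ,ν}` (`edgeOffsets`, `mem_edgeOffsets`; `n^{d−2}` plaquettes), `(Q^e_k f)_{μν}(y) = η^{d−2}Σ_{x∈B^e_k(y;μν)}f_{μν}(x)`
(`edgeAvgC_mulVec`).  `ω_ρ = e^{iηp_ρ}`, `v_ρ`, `u` at `p = p′+l ↔ pOf n M (k,q)` are `B5Block118.om`, `B5Prop11Fiber.vSym/uSym`.
WHAT IS KERNEL-CHECKED (zero `sorry`, standard axioms; the block partition is pub-balaban's `B5Blocks16.bpt_bijective`):
`edgeAvgC_mulVec`; `isCrossTI_edgeAvgC`; the symbol **`symbX_edgeAvgC_pOf`**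
(`σ_{Q^e_k}(p′+l) = δ·w_{μν}(p′+l)`, `edgeW`) with the closed form **`edgeW_eq`** `w_{μν} = ω_μ^{n−1}ω_ν^{n−1}Π_{ρ∉{μ,ν}}v_ρ`
(`ω^{n−1} = e^{i(1−η)p}`); the phase identity **`om_pow_mul_conj_vSym`** `e^{i(1−η)p_ρ}·v̄_ρ(p) = v_ρ(p)`; **(7.1.11) corrected,
division-free `edgeW_mul_conj_vSym`** `w_{μν}·v̄_μ·v̄_ν = u` and, off the zeros of `v_μv_ν`, `edgeW_eq_div` `w_{μν} = u/(v̄_μ v̄_ν)`;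
`norm_edgeW` (`|w_{μν}| = Π_{ρ∉{μ,ν}}|v_ρ|`, so `|w_{μν}|·|v_μ||v_ν| = |u|`: the moduli entering (7.1.10)/(7.1.14)/(7.1.16) do not see
the phase, `norm_edgeW_mul`); and **`dft_edgeAvgC`**: `(Q^e_k f)^_{μν}(p′) = c·Σ_l w_{μν}(p′+l) f̂_{μν}(p′+l)`, `c = n^{−d/2}`
(`B5Block118.cQ`, `= 1` in the paper's weighted conventions).  NOT CLAIMED here: the adjoint (2.22)_k and (2.24) (sibling
`BIJ85Eq7111EdgeAdjoint`), the symbols of Q_k/G_k and (7.1.13).  Unit `lit-balaban-p27` (gen 5), HOME as above.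
-/

namespace Literature.MathematicalPhysics.QuantumFieldTheory.BalabanImbrieJaffe1984to88.BIJ85Eq7111EdgeAverage

open scoped BigOperators Matrix ComplexConjugate
open Finset Complex
open Literature.MathematicalPhysics.QuantumFieldTheory.Balaban1983to89
open Literature.MathematicalPhysics.QuantumFieldTheory.Balaban1983to89.B5Prop11Plancherel
open Literature.MathematicalPhysics.QuantumFieldTheory.Balaban1983to89.B5Prop11Fiber
open Literature.MathematicalPhysics.QuantumFieldTheory.Balaban1983to89.B5Block118
open Literature.MathematicalPhysics.QuantumFieldTheory.Balaban1983to89.B5Blocks16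
open Literature.MathematicalPhysics.QuantumFieldTheory.BalabanImbrieJaffe1984to88.BIJ85Eq712Plancherel
open Literature.MathematicalPhysics.QuantumFieldTheory.BalabanImbrieJaffe1984to88.BIJ85Eq712SymbolCalculus
open Literature.MathematicalPhysics.QuantumFieldTheory.BalabanImbrieJaffe1984to88.BIJ85Eq7111CrossSymbols

noncomputable section

variable {d : ℕ} (n : ℕ) [NeZero n] (M : Fin d → ℕ) [hM : ∀ μ, NeZero (M μ)]

/-! ## §1 Block geometry (the partition of `T_η` into the blocks `B^k(y)` is pub-balaban's `B5Blocks16`) -/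

omit [NeZero n] hM in
/-- kernel: `up 0 = 0`. [cite: Balaban1984PropagatorsI, (1.18) p.20] -/
theorem up_zero : up n M 0 = 0 := by
  funext ν; show upHom n M ν ((0 : Tor M) ν) = 0; rw [Pi.zero_apply, map_zero]

omit [NeZero n] hM in
/-- kernel: `B^k(0)` consists of the offsets themselves. [cite: Balaban1984PropagatorsI, (1.6) p.18] -/
theorem bpt_zero (j : Fin d → Fin n) : bpt n M 0 j = iota n M j := by
  rw [bpt, up_zero, zero_add]

omit [NeZero n] hM in
/-- kernel: `B^k(y + a) = B^k(y) + n·a` pointwise. [cite: Balaban1984PropagatorsI, (1.18) p.20] -/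
theorem bpt_add (y a : Tor M) (j : Fin d → Fin n) : bpt n M (y + a) j = bpt n M y j + up n M a := by
  rw [bpt, bpt, up_add]; abel

/-! ## §2 The edge plaquettes `B^e_k(y; μν)` and the k-fold edge average `Q^e_k` -/

/-- the last fine layer `n − 1` of a block (`x_μ = y_μ + 1 − η`). [cite: BalabanImbrieJaffe1985, (2.21) p.305] -/
def topIdx : Fin n := ⟨n - 1, Nat.sub_lt (Nat.pos_of_ne_zero (NeZero.ne n)) Nat.one_pos⟩

/-- the admissible offsets per direction of an edge plaquette of orientation `μν`: `n − 1` in the directions `μ`, `ν`, anything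
transversally. [cite: BalabanImbrieJaffe1985, (2.21) p.305] -/
def edgeSlots (μ ν ρ : Fin d) : Finset (Fin n) := if ρ = μ ∨ ρ = ν then {topIdx n} else Finset.univ

/-- **The edge plaquettes `B^e_k(y; μν)`** of the unit plaquette at `y` with orientation `μν`, as offsets `j` in the block `B^k(y)`:
the η-plaquettes parallel to `μν` whose bonds touch the four blocks `B^k(y)`, `B^k(y+e_μ)`, `B^k(y+e_ν)`, `B^k(y+e_μ+e_ν)` around the
corners of the unit plaquette — (2.21) *"(i) are parallel to p′, (ii) whose bonds touch four distinct L-blocks, and (iii) such that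
these L-blocks contain the corners of p′"* composed k times: `j_μ = j_ν = n − 1`, `j_ρ` free for `ρ ∉ {μ,ν}`.
[cite: BalabanImbrieJaffe1985, (2.21) p.305] -/
def edgeOffsets (μ ν : Fin d) : Finset (Fin d → Fin n) := Fintype.piFinset (edgeSlots n μ ν)

/-- `j ∈ B^e_k(·; μν)` iff `j_μ = j_ν = n − 1` (`x_μ = y_μ + 1 − η`, `x_ν = y_ν + 1 − η`, transverse coordinates free).
[cite: BalabanImbrieJaffe1985, (2.21) p.305] -/
theorem mem_edgeOffsets {μ ν : Fin d} {j : Fin d → Fin n} :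
    j ∈ edgeOffsets n μ ν ↔ j μ = topIdx n ∧ j ν = topIdx n := by
  simp only [edgeOffsets, Fintype.mem_piFinset, edgeSlots]
  constructor
  · intro h
    have hμ := h μ
    have hν := h ν
    rw [if_pos (Or.inl rfl), Finset.mem_singleton] at hμ
    rw [if_pos (Or.inr rfl), Finset.mem_singleton] at hν
    exact ⟨hμ, hν⟩
  · rintro ⟨hμ, hν⟩ ρ
    split_ifs with h
    · rcases h with rfl | rfl
      · rw [Finset.mem_singleton]; exact hμ
      · rw [Finset.mem_singleton]; exact hν
    · exact Finset.mem_univ _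

/-- **The k-fold edge average `Q^e_k = (Q^e)^k`** from η-plaquette fields to unit plaquette fields, configuration space:
`(Q^e_k f)_{μν}(y) = η^{d−2} Σ_{x ∈ B^e_k(y;μν)} f_{μν}(x)` ((2.21) `L^{−(d−2)}Σ_{p∈B(p′)}` composed k times; diagonal in the
orientation). [cite: BalabanImbrieJaffe1985, (2.21) p.305] -/
def edgeAvgC : Matrix (Tor M × (Fin d × Fin d)) (Tor (fine n M) × (Fin d × Fin d)) ℂ :=
  Matrix.of fun a b => if b.2 = a.2 then
    ∑ j ∈ edgeOffsets n a.2.1 a.2.2, (if b.1 = bpt n M a.1 j then (((n : ℂ) ^ (d - 2))⁻¹) else 0) else 0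

/-- `(Q^e_k f)_{μν}(y) = η^{d−2} Σ_{j ∈ B^e_k(μν)} f_{μν}(n·y + j)`. [cite: BalabanImbrieJaffe1985, (2.21) p.305] -/
theorem edgeAvgC_mulVec (f : Tor (fine n M) × (Fin d × Fin d) → ℂ) (y : Tor M) (μ ν : Fin d) :
    (edgeAvgC n M *ᵥ f) (y, (μ, ν))
      = ((n : ℂ) ^ (d - 2))⁻¹ * ∑ j ∈ edgeOffsets n μ ν, f (bpt n M y j, (μ, ν)) := by
  simp only [Matrix.mulVec, dotProduct, edgeAvgC, Matrix.of_apply]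
  rw [Fintype.sum_prod_type]
  have h1 : ∀ x : Tor (fine n M), ∑ b : Fin d × Fin d,
      (if b = (μ, ν) then ∑ j ∈ edgeOffsets n μ ν, (if x = bpt n M y j then (((n : ℂ) ^ (d - 2))⁻¹) else 0) else 0)
        * f (x, b)
      = ∑ j ∈ edgeOffsets n μ ν, (if x = bpt n M y j then (((n : ℂ) ^ (d - 2))⁻¹) else 0) * f (x, (μ, ν)) := by
    intro x
    rw [Finset.sum_eq_single (μ, ν)]
    · rw [if_pos rfl, Finset.sum_mul]
    · intro b _ hb
      rw [if_neg hb, zero_mul]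
    · exact fun h => absurd (Finset.mem_univ _) h
  simp_rw [h1]
  rw [Finset.sum_comm, Finset.mul_sum]
  refine Finset.sum_congr rfl fun j _ => ?_
  simp only [ite_mul, zero_mul, Finset.sum_ite_eq', Finset.mem_univ, if_true]

omit hM in
/-- `Q^e_k` is translation invariant (commutes with the unit-lattice translations): `B^e_k(y+a) = B^e_k(y) + n·a`.
[cite: BalabanImbrieJaffe1985, (7.1.11) p.322] -/
theorem isCrossTI_edgeAvgC : IsCrossTI n M (Fin d × Fin d) (Fin d × Fin d) (edgeAvgC n M) := by
  intro a y x i j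
  simp only [edgeAvgC, Matrix.of_apply, bpt_add, add_left_inj]

/-! ## §3 The symbol of `Q^e_k`: (7.1.11) with the exact phase -/

/-- The WEIGHT of (7.1.11) as the configuration-space operator produces it, at `p = p′ + l ↔ (k, q)`, `s = p′`:
`w_{μν}(p) = η^{d−2}·Π_ρ Σ_{t ∈ slots_ρ} ω_ρ^t`, `ω_ρ = e^{iηp_ρ}` (`B5Block118.om`) — closed form `edgeW_eq`.
[cite: BalabanImbrieJaffe1985, (7.1.11) p.322] -/
def edgeW (k : Fin d → Fin n) (s : Fin d → ℝ) (μ ν : Fin d) : ℂ :=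
  ((n : ℂ) ^ (d - 2))⁻¹ * ∏ ρ, ∑ t ∈ edgeSlots n μ ν ρ, om n k s ρ ^ (t : ℕ)

/-- The symbol of `Q^e_k` at a fine momentum `p`: diagonal in the orientation, `η^{d−2}Σ_{j∈B^e_k(μν)} e^{ip·ηj}`.
[cite: BalabanImbrieJaffe1985, (7.1.11) p.322] -/
theorem symbX_edgeAvgC (p : Tor (fine n M)) (μ ν μ' ν' : Fin d) :
    symbX n M (Fin d × Fin d) (Fin d × Fin d) (edgeAvgC n M) p (μ, ν) (μ', ν')
      = if (μ', ν') = (μ, ν) then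
          ((n : ℂ) ^ (d - 2))⁻¹ * ∑ j ∈ edgeOffsets n μ ν, chi (fine n M) p (iota n M j) else 0 := by
  rw [symbX_apply]
  simp only [edgeAvgC, Matrix.of_apply]
  split_ifs with h
  · simp_rw [Finset.sum_mul, ite_mul, zero_mul]
    rw [Finset.sum_comm, Finset.mul_sum]
    refine Finset.sum_congr rfl fun j _ => ?_
    rw [Finset.sum_ite_eq' Finset.univ (bpt n M 0 j), if_pos (Finset.mem_univ _), bpt_zero]
  · simp only [zero_mul, Finset.sum_const_zero]

/-- **The symbol of `Q^e_k` at `p = p′ + l`**: `σ_{Q^e_k}(p′+l)_{(μν),(μ′ν′)} = δ_{(μν),(μ′ν′)}·w_{μν}(p′+l)`.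
[cite: BalabanImbrieJaffe1985, (7.1.11) p.322] -/
theorem symbX_edgeAvgC_pOf (k : Fin d → Fin n) (q : Tor M) (μ ν μ' ν' : Fin d) :
    symbX n M (Fin d × Fin d) (Fin d × Fin d) (edgeAvgC n M) (pOf n M (k, q)) (μ, ν) (μ', ν')
      = if (μ', ν') = (μ, ν) then edgeW n k (sOf M q) μ ν else 0 := by
  rw [symbX_edgeAvgC]
  split_ifs with h
  · rw [edgeW, edgeOffsets]
    simp_rw [chi_pOf_iota]
    rw [← Finset.prod_univ_sum (edgeSlots n μ ν) (fun ρ (t : Fin n) => om n k (sOf M q) ρ ^ (t : ℕ))]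
  · rfl

omit hM in
/-- kernel: the singleton slot contributes the phase `ω^{n−1} = e^{i(1−η)p}`. [cite: BalabanImbrieJaffe1985, (7.1.11) p.322] -/
private theorem sum_singleton_top (k : Fin d → Fin n) (s : Fin d → ℝ) (ρ : Fin d) :
    ∑ t ∈ ({topIdx n} : Finset (Fin n)), om n k s ρ ^ (t : ℕ) = om n k s ρ ^ (n - 1) := by
  rw [Finset.sum_singleton]
  rfl

omit hM in
/-- kernel: `|{ρ : ρ ≠ μ, ρ ≠ ν}| = d − 2` for `μ ≠ ν`. [folklore] -/
private theorem card_erase_erase {μ ν : Fin d} (hμν : μ ≠ ν) : ((Finset.univ.erase μ).erase ν).card = d - 2 := by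
  rw [Finset.card_erase_of_mem (Finset.mem_erase.mpr ⟨Ne.symm hμν, Finset.mem_univ ν⟩),
    Finset.card_erase_of_mem (Finset.mem_univ μ), Finset.card_univ, Fintype.card_fin]
  omega

omit hM in
/-- **The closed form of the weight** (for an orientation `μ ≠ ν`): `w_{μν}(p) = ω_μ^{n−1}ω_ν^{n−1}·Π_{ρ∉{μ,ν}} v_ρ(p)` — the
transverse block average `Π_{ρ∉{μ,ν}}v_ρ = u/(v_μv_ν)` of (7.1.11) times the base-point phase `e^{i(1−η)(p_μ+p_ν)}` of the last
fine layer (`v_ρ` = `B5Prop11Fiber.vSym`, the geometric sum `B5Block118.avg_om`). [cite: BalabanImbrieJaffe1985, (7.1.11) p.322] -/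
theorem edgeW_eq (k : Fin d → Fin n) (q : Tor M) {μ ν : Fin d} (hμν : μ ≠ ν) :
    edgeW n k (sOf M q) μ ν
      = om n k (sOf M q) μ ^ (n - 1) * om n k (sOf M q) ν ^ (n - 1)
          * ∏ ρ ∈ (Finset.univ.erase μ).erase ν, vSym n k (sOf M q) ρ := by
  have hn : (n : ℂ) ≠ 0 := by exact_mod_cast NeZero.ne n
  have hν : ν ∈ Finset.univ.erase μ := Finset.mem_erase.mpr ⟨Ne.symm hμν, Finset.mem_univ ν⟩
  have hrest : ∀ ρ ∈ (Finset.univ.erase μ).erase ν,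
      ∑ t ∈ edgeSlots n μ ν ρ, om n k (sOf M q) ρ ^ (t : ℕ) = (n : ℂ) * vSym n k (sOf M q) ρ := by
    intro ρ hρ
    have hρν : ρ ≠ ν := (Finset.mem_erase.mp hρ).1
    have hρμ : ρ ≠ μ := (Finset.mem_erase.mp (Finset.mem_erase.mp hρ).2).1
    rw [edgeSlots, if_neg (not_or.mpr ⟨hρμ, hρν⟩), avg_om]
  rw [edgeW, ← Finset.mul_prod_erase _ _ (Finset.mem_univ μ), ← Finset.mul_prod_erase _ _ hν,
    Finset.prod_congr rfl hrest, Finset.prod_mul_distrib, Finset.prod_const, card_erase_erase hμν]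
  rw [edgeSlots, if_pos (Or.inl rfl), edgeSlots, if_pos (Or.inr rfl), sum_singleton_top, sum_singleton_top]
  field_simp

/-! ## §4 The phase identity `e^{i(1−η)p_ρ}·v̄_ρ = v_ρ` and (7.1.11) corrected -/

omit [NeZero n] hM in
/-- kernel: `|ω_ρ| = 1`, so `ω̄_ρ = ω_ρ^{−1}`. [cite: BalabanImbrieJaffe1985, (7.1.4) p.322] -/
theorem conj_om (k : Fin d → Fin n) (s : Fin d → ℝ) (ρ : Fin d) : conj (om n k s ρ) = (om n k s ρ)⁻¹ := by
  rw [om, ← Complex.exp_conj, ← Complex.exp_neg, map_mul, Complex.conj_ofReal, Complex.conj_I, mul_neg]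

omit [NeZero n] hM in
/-- kernel: `|ω_ρ| = 1`. [cite: BalabanImbrieJaffe1985, (7.1.4) p.322] -/
theorem norm_om (k : Fin d → Fin n) (s : Fin d → ℝ) (ρ : Fin d) : ‖om n k s ρ‖ = 1 := by
  rw [om, Complex.norm_exp_ofReal_mul_I]

omit hM in
/-- `n·v_ρ(p′+l) = Σ_{t<n} ω_ρ^t` (`B5Block118.avg_om` over `range n`). [cite: BalabanImbrieJaffe1985, (7.1.7) p.322] -/
theorem natCast_mul_vSym (k : Fin d → Fin n) (q : Tor M) (ρ : Fin d) :
    (n : ℂ) * vSym n k (sOf M q) ρ = ∑ t ∈ Finset.range n, om n k (sOf M q) ρ ^ t := by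
  rw [← avg_om, Fin.sum_univ_eq_sum_range (fun t => om n k (sOf M q) ρ ^ t) n]

omit hM in
/-- **THE PHASE IDENTITY** `e^{i(1−η)p_ρ}·conj v_ρ(p) = v_ρ(p)`: the averaging symbol `v_ρ(p) = ηΣ_{t<n}e^{iηtp_ρ}` is real up to
the half-block phase `e^{i(1−η)p_ρ/2}`, so reflecting the block (`t ↦ n−1−t`) conjugates it; this is why `u/(v̄_μv̄_ν)` and the
printed `u/(v_μv_ν)` of (7.1.11) differ exactly by `e^{i(1−η)(p_μ+p_ν)}`. [cite: BalabanImbrieJaffe1985, (7.1.11) p.322] -/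
theorem om_pow_mul_conj_vSym (k : Fin d → Fin n) (q : Tor M) (ρ : Fin d) :
    om n k (sOf M q) ρ ^ (n - 1) * conj (vSym n k (sOf M q) ρ) = vSym n k (sOf M q) ρ := by
  have hn : (n : ℂ) ≠ 0 := by exact_mod_cast NeZero.ne n
  have hω : om n k (sOf M q) ρ ≠ 0 := Complex.exp_ne_zero _
  apply mul_left_cancel₀ hn
  calc (n : ℂ) * (om n k (sOf M q) ρ ^ (n - 1) * conj (vSym n k (sOf M q) ρ))
      = om n k (sOf M q) ρ ^ (n - 1) * conj ((n : ℂ) * vSym n k (sOf M q) ρ) := by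
        rw [map_mul, Complex.conj_natCast]
        ring
    _ = ∑ t ∈ Finset.range n, om n k (sOf M q) ρ ^ (n - 1 - t) := by
        rw [natCast_mul_vSym, map_sum, Finset.mul_sum]
        refine Finset.sum_congr rfl fun t ht => ?_
        rw [map_pow, conj_om, inv_pow, pow_sub₀ _ hω (Nat.le_sub_one_of_lt (Finset.mem_range.mp ht))]
    _ = ∑ t ∈ Finset.range n, om n k (sOf M q) ρ ^ t := Finset.sum_range_reflect _ n
    _ = (n : ℂ) * vSym n k (sOf M q) ρ := (natCast_mul_vSym n M k q ρ).symm

omit [NeZero n] in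
/-- kernel: `v_μ v_ν Π_{ρ∉{μ,ν}} v_ρ = Π_ρ v_ρ = u`. [cite: BalabanImbrieJaffe1985, (7.1.9) p.322] -/
private theorem vSym_mul_vSym_mul_prod (k : Fin d → Fin n) (s : Fin d → ℝ) {μ ν : Fin d} (hμν : μ ≠ ν) :
    vSym n k s μ * vSym n k s ν * ∏ ρ ∈ (Finset.univ.erase μ).erase ν, vSym n k s ρ = uSym n k s := by
  have hν : ν ∈ Finset.univ.erase μ := Finset.mem_erase.mpr ⟨Ne.symm hμν, Finset.mem_univ ν⟩
  rw [uSym, ← Finset.mul_prod_erase _ _ (Finset.mem_univ μ), ← Finset.mul_prod_erase _ _ hν, mul_assoc]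

omit hM in
/-- **(7.1.11), CORRECTED AND DIVISION-FREE**: the weight of the configuration-space `Q^e_k` satisfies
`w_{μν}(p)·v̄_μ(p)·v̄_ν(p) = u(p)` at every `p = p′ + l` (orientation `μ ≠ ν`) — i.e. `w_{μν} = u/(v̄_μ v̄_ν)` wherever `v_μv_ν ≠ 0`,
versus the printed `u(v_μv_ν)^{−1}`. [cite: BalabanImbrieJaffe1985, (7.1.11) p.322] -/
theorem edgeW_mul_conj_vSym (k : Fin d → Fin n) (q : Tor M) {μ ν : Fin d} (hμν : μ ≠ ν) :
    edgeW n k (sOf M q) μ ν * conj (vSym n k (sOf M q) μ) * conj (vSym n k (sOf M q) ν) = uSym n k (sOf M q) := by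
  rw [edgeW_eq n M k q hμν, ← vSym_mul_vSym_mul_prod n k (sOf M q) hμν]
  have hμ' := om_pow_mul_conj_vSym n M k q μ
  have hν' := om_pow_mul_conj_vSym n M k q ν
  calc om n k (sOf M q) μ ^ (n - 1) * om n k (sOf M q) ν ^ (n - 1)
          * (∏ ρ ∈ (Finset.univ.erase μ).erase ν, vSym n k (sOf M q) ρ)
          * conj (vSym n k (sOf M q) μ) * conj (vSym n k (sOf M q) ν)
      = (om n k (sOf M q) μ ^ (n - 1) * conj (vSym n k (sOf M q) μ))
          * (om n k (sOf M q) ν ^ (n - 1) * conj (vSym n k (sOf M q) ν))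
          * ∏ ρ ∈ (Finset.univ.erase μ).erase ν, vSym n k (sOf M q) ρ := by ring
    _ = vSym n k (sOf M q) μ * vSym n k (sOf M q) ν * ∏ ρ ∈ (Finset.univ.erase μ).erase ν, vSym n k (sOf M q) ρ := by
        rw [hμ', hν']

omit hM in
/-- … hence, off the zero set of `v_μ v_ν`, `w_{μν}(p′+l) = u/(v̄_μ v̄_ν)(p′+l)`. [cite: BalabanImbrieJaffe1985, (7.1.11) p.322] -/
theorem edgeW_eq_div (k : Fin d → Fin n) (q : Tor M) {μ ν : Fin d} (hμν : μ ≠ ν) (hμ : vSym n k (sOf M q) μ ≠ 0)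
    (hν : vSym n k (sOf M q) ν ≠ 0) :
    edgeW n k (sOf M q) μ ν = uSym n k (sOf M q) / (conj (vSym n k (sOf M q) μ) * conj (vSym n k (sOf M q) ν)) := by
  have hμ' : conj (vSym n k (sOf M q) μ) ≠ 0 := (map_ne_zero (starRingEnd ℂ)).mpr hμ
  have hν' : conj (vSym n k (sOf M q) ν) ≠ 0 := (map_ne_zero (starRingEnd ℂ)).mpr hν
  rw [eq_div_iff (mul_ne_zero hμ' hν'), ← edgeW_mul_conj_vSym n M k q hμν, mul_assoc]

omit hM in
/-- **The printed weight is the modulus-correct one**: `|w_{μν}(p)| = Π_{ρ∉{μ,ν}}|v_ρ(p)| = |u/(v_μv_ν)|` (the phase has modulus 1),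
so the moduli `|u v_μ|²`, `|u|²/(v̄v̄vv)`, `|u/v_μ|²` of (7.1.10)/(7.1.14)/(7.1.16) are insensitive to the convention.
[cite: BalabanImbrieJaffe1985, (7.1.10) p.322] -/
theorem norm_edgeW (k : Fin d → Fin n) (q : Tor M) {μ ν : Fin d} (hμν : μ ≠ ν) :
    ‖edgeW n k (sOf M q) μ ν‖ = ∏ ρ ∈ (Finset.univ.erase μ).erase ν, ‖vSym n k (sOf M q) ρ‖ := by
  rw [edgeW_eq n M k q hμν, norm_mul, norm_mul, norm_pow, norm_pow, norm_om, norm_om, one_pow, one_mul, one_mul,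
    Complex.norm_prod]

omit hM in
/-- `|w_{μν}|·|v_μ|·|v_ν| = |u|`. [cite: BalabanImbrieJaffe1985, (7.1.10) p.322] -/
theorem norm_edgeW_mul (k : Fin d → Fin n) (q : Tor M) {μ ν : Fin d} (hμν : μ ≠ ν) :
    ‖edgeW n k (sOf M q) μ ν‖ * ‖vSym n k (sOf M q) μ‖ * ‖vSym n k (sOf M q) ν‖ = ‖uSym n k (sOf M q)‖ := by
  rw [← edgeW_mul_conj_vSym n M k q hμν, norm_mul, norm_mul, Complex.norm_conj, Complex.norm_conj]

/-! ## §5 (7.1.11): the momentum representation of `Q^e_k f` -/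

/-- **(7.1.11)** p. 322 [PDF 24], *"(Q^e_k f)~_{μν}(p′) = Σ_l u(p′+l) f̃_{μν}(p′+l)(v_μ(p′+l)v_ν(p′+l))^{−1}"* — PROVED for the
configuration-space operator (2.21)^k on the tori, with the exact weight: `(Q^e_k f)^_{μν}(p′) = c·Σ_l w_{μν}(p′+l) f̂_{μν}(p′+l)`,
`w_{μν} = e^{i(1−η)(p_μ+p_ν)}·u/(v_μv_ν)` (`edgeW_eq`, `edgeW_mul_conj_vSym`), `c = n^{−d/2}` the ratio of the unitary DFT
normalisations (`= 1` with the weights η^d, 1 of (2.20)/(1.29)), the `Σ_l` = the `n^d` offsets `k`.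
[cite: BalabanImbrieJaffe1985, (7.1.11) p.322] -/
theorem dft_edgeAvgC (f : Tor (fine n M) × (Fin d × Fin d) → ℂ) (q : Tor M) (μ ν : Fin d) :
    (dftC M (Fin d × Fin d) *ᵥ (edgeAvgC n M *ᵥ f)) (q, (μ, ν))
      = (cQ n M : ℂ) * ∑ k : Fin d → Fin n,
          edgeW n k (sOf M q) μ ν * (dftC (fine n M) (Fin d × Fin d) *ᵥ f) (pOf n M (k, q), (μ, ν)) := by
  rw [dftC_mulVec_cross n M (Fin d × Fin d) (Fin d × Fin d) (isCrossTI_edgeAvgC n M) f q (μ, ν)]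
  congr 1
  refine Finset.sum_congr rfl fun k _ => ?_
  rw [Finset.sum_eq_single (μ, ν)]
  · rw [symbX_edgeAvgC_pOf, if_pos rfl]
  · rintro ⟨μ', ν'⟩ _ hb
    rw [symbX_edgeAvgC_pOf, if_neg hb, zero_mul]
  · exact fun h => absurd (Finset.mem_univ _) h

end

end Literature.MathematicalPhysics.QuantumFieldTheory.BalabanImbrieJaffe1984to88.BIJ85Eq7111EdgeAverage
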